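import Summits.AtomisticToContinuum.Crystallization.Theorems.PhononSlackCertificatesHullBridgeWindows

/-!
# `BarlowLiouville` (route `DisclinationRation`), stub `stub_uniformSpacing`: one in-layer
# spacing for all scales

Support file for item stmt-AtomisticToContinuum-15801 (crux
`Summit.AtomisticToContinuum.Crystallization.Theses.DisclinationRation.BarlowLiouville`, line
`Sketch`). Pure geometry / bookkeeping about the PATCH predicate of the line (a two-way `η`-match on
`‖·‖ ≤ R` of a translate `X + t` of a point set `X ⊆ ℝ³` with a rigid image
`{A (i u(a) + j v(a) + L_s(m) w(a) + z(m) e₃)}` of a relaxed layered set of in-layer spacing `a`):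

* `us_patch_mono` — a patch is monotone in its radius and tolerance;
* `us_patch_rescale` — the set version of the landed `hb_window_rescale`: a `(2R+1, η/2)`-patch with
  spacing `a'` gives an `(R, η)`-patch with any spacing `a`, `|a - a'| ≤ η/(8(R+1))` (homothety of
  ratio `a/a'` of the layered set only, heights rescaled with it so the interlayer box
  `[39a/50, 17a/20]` is kept; the translate `X + t` is untouched);
* `us_exists_global_spacing` — abstract accumulation-point argument (plain sequences, no filter in
  `N`): if admissible spacings `W R η ⊆ [47/50, 1]` are monotone, stable under the rescaling, and
  nonempty for every `(R, η)`, `η > 0`, then ONE spacing serves every `(R, η)`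
  (`IsCompact.tendsto_subseq` on the spacings of the `(k, 1/(k+1))`-patches);
* `stub_uniformSpacing` — the registered stub, by instantiating `W`.

No new definitions; nothing here uses any hypothesis on `X`.
-/

namespace Summit.AtomisticToContinuum.Crystallization.Theorems.DisclinationRationBarlowLiouville

open Filter Topology
open Literature.MathematicalPhysics.StatisticalMechanics Literature.Geometry.DiscreteGeometry

/-- Euclidean `3`-space. -/
local notation "E3" => EuclideanSpace ℝ (Fin 3)

/-! ## Patches: monotonicity -/

/-- A patch is monotone in its radius and tolerance. [folklore] -/
theorem us_patch_mono (X : Set E3) {R R₂ η η₂ a : ℝ} (hR : R₂ ≤ R) (hη : η ≤ η₂)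
    (hW : ∃ (A : E3 →ₗᵢ[ℝ] E3) (t : E3) (s : ℤ → ℤ) (z : ℤ → ℝ), IsHaggSeq s ∧
      (∀ m : ℤ, 39 / 50 * a ≤ z (m + 1) - z m ∧ z (m + 1) - z m ≤ 17 / 20 * a) ∧
      let S : Set E3 := {p | ∃ m i j : ℤ, p = A (((i : ℝ) • triangularVec₁ a) +
        ((j : ℝ) • triangularVec₂ a) + ((haggLabel s m : ℝ) • barlowOffset a) + (z m • layerNormal 1))}
      (∀ p ∈ S, ‖p‖ ≤ R → ∃ q ∈ X, dist (q + t) p ≤ η) ∧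
      (∀ q ∈ X, ‖q + t‖ ≤ R → ∃ p ∈ S, dist (q + t) p ≤ η)) :
    ∃ (A : E3 →ₗᵢ[ℝ] E3) (t : E3) (s : ℤ → ℤ) (z : ℤ → ℝ), IsHaggSeq s ∧
      (∀ m : ℤ, 39 / 50 * a ≤ z (m + 1) - z m ∧ z (m + 1) - z m ≤ 17 / 20 * a) ∧
      let S : Set E3 := {p | ∃ m i j : ℤ, p = A (((i : ℝ) • triangularVec₁ a) +
        ((j : ℝ) • triangularVec₂ a) + ((haggLabel s m : ℝ) • barlowOffset a) + (z m • layerNormal 1))}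
      (∀ p ∈ S, ‖p‖ ≤ R₂ → ∃ q ∈ X, dist (q + t) p ≤ η₂) ∧
      (∀ q ∈ X, ‖q + t‖ ≤ R₂ → ∃ p ∈ S, dist (q + t) p ≤ η₂) := by
  obtain ⟨A, t, s, z, hs, hz, h12⟩ := hW
  dsimp only at h12
  obtain ⟨h1, h2⟩ := h12
  refine ⟨A, t, s, z, hs, hz, ?_⟩
  dsimp only
  refine ⟨fun p hp hpR => ?_, fun q hq hqR => ?_⟩
  · obtain ⟨q, hq, hd⟩ := h1 p hp (hpR.trans hR)
    exact ⟨q, hq, hd.trans hη⟩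
  · obtain ⟨p, hp, hd⟩ := h2 q hq (hqR.trans hR)
    exact ⟨p, hp, hd.trans hη⟩

/-! ## Patches: rescaling to a prescribed in-layer spacing -/

/-- **Rescaling a patch** (set version of `hb_window_rescale`). A patch of radius `2R + 1` and
tolerance `η/2` whose layered set has in-layer spacing `a'` yields, after the homothety of ratio
`a/a'` of the layered set (heights rescaled with it, so the interlayer constraints are kept; the
translate `X + t` is untouched), a patch of radius `R` and tolerance `η` with in-layer spacing `a`,
as soon as `|a - a'| ≤ η / (8 (R + 1))` (both spacings in `[47/50, 1]`). [folklore] -/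
theorem us_patch_rescale (X : Set E3) {R η a a' : ℝ}
    (hR : 0 ≤ R) (hη : 0 < η) (ha : 47 / 50 ≤ a) (ha1 : a ≤ 1) (ha' : 47 / 50 ≤ a')
    (ha'1 : a' ≤ 1) (haa : |a - a'| ≤ η / (8 * (R + 1)))
    (hW : ∃ (A : E3 →ₗᵢ[ℝ] E3) (t : E3) (s : ℤ → ℤ) (z : ℤ → ℝ), IsHaggSeq s ∧
      (∀ m : ℤ, 39 / 50 * a' ≤ z (m + 1) - z m ∧ z (m + 1) - z m ≤ 17 / 20 * a') ∧
      let S : Set E3 := {p | ∃ m i j : ℤ, p = A (((i : ℝ) • triangularVec₁ a') +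
        ((j : ℝ) • triangularVec₂ a') + ((haggLabel s m : ℝ) • barlowOffset a') +
        (z m • layerNormal 1))}
      (∀ p ∈ S, ‖p‖ ≤ 2 * R + 1 → ∃ q ∈ X, dist (q + t) p ≤ η / 2) ∧
      (∀ q ∈ X, ‖q + t‖ ≤ 2 * R + 1 → ∃ p ∈ S, dist (q + t) p ≤ η / 2)) :
    ∃ (A : E3 →ₗᵢ[ℝ] E3) (t : E3) (s : ℤ → ℤ) (z : ℤ → ℝ), IsHaggSeq s ∧
      (∀ m : ℤ, 39 / 50 * a ≤ z (m + 1) - z m ∧ z (m + 1) - z m ≤ 17 / 20 * a) ∧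
      let S : Set E3 := {p | ∃ m i j : ℤ, p = A (((i : ℝ) • triangularVec₁ a) +
        ((j : ℝ) • triangularVec₂ a) + ((haggLabel s m : ℝ) • barlowOffset a) + (z m • layerNormal 1))}
      (∀ p ∈ S, ‖p‖ ≤ R → ∃ q ∈ X, dist (q + t) p ≤ η) ∧
      (∀ q ∈ X, ‖q + t‖ ≤ R → ∃ p ∈ S, dist (q + t) p ≤ η) := by
  -- adapted from `hb_window_rescale` (particles `y i + t` replaced by set points `q + t`, `q ∈ X`)
  obtain ⟨A, t, s, z, hs, hz, h12⟩ := hW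
  dsimp only at h12
  obtain ⟨h1, h2⟩ := h12
  have ha'0 : 0 < a' := by linarith
  have ha0 : 0 < a := by linarith
  set c : ℝ := a / a' with hc
  have hc0 : 0 < c := div_pos ha0 ha'0
  have hca : c * a' = a := div_mul_cancel₀ a ha'0.ne'
  have hXa : |c - 1| * a' = |a - a'| := by
    rw [← abs_of_pos ha'0, ← abs_mul, abs_of_pos ha'0, sub_mul, hca, one_mul]
  -- the rescaled point is `c •` the old one
  have key : ∀ m i j : ℤ, A (((i : ℝ) • triangularVec₁ a) + ((j : ℝ) • triangularVec₂ a) +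
      ((haggLabel s m : ℝ) • barlowOffset a) + ((c * z m) • layerNormal 1)) =
      c • A (((i : ℝ) • triangularVec₁ a') + ((j : ℝ) • triangularVec₂ a') +
      ((haggLabel s m : ℝ) • barlowOffset a') + (z m • layerNormal 1)) := by
    intro m i j
    have := hb_layeredPoint_mul A c a' s z m i j
    rwa [hca] at this
  have hdist : ∀ q : E3, dist q (c • q) = |c - 1| * ‖q‖ := by
    intro q
    rw [dist_eq_norm, show q - c • q = (1 - c) • q by rw [sub_smul, one_smul], norm_smul,
      Real.norm_eq_abs, abs_sub_comm]
  refine ⟨A, t, s, fun m => c * z m, hs, fun m => ?_, ?_⟩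
  · obtain ⟨hl, hu⟩ := hz m
    have e1 : c * z (m + 1) - c * z m = c * (z (m + 1) - z m) := by ring
    rw [e1]
    constructor
    · calc 39 / 50 * a = c * (39 / 50 * a') := by rw [← hca]; ring
        _ ≤ c * (z (m + 1) - z m) := mul_le_mul_of_nonneg_left hl hc0.le
    · calc c * (z (m + 1) - z m) ≤ c * (17 / 20 * a') := mul_le_mul_of_nonneg_left hu hc0.le
        _ = 17 / 20 * a := by rw [← hca]; ring
  dsimp only
  constructor
  · rintro p ⟨m, i, j, rfl⟩ hpR
    set q : E3 := A (((i : ℝ) • triangularVec₁ a') + ((j : ℝ) • triangularVec₂ a') +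
      ((haggLabel s m : ℝ) • barlowOffset a') + (z m • layerNormal 1)) with hq
    rw [key] at hpR ⊢
    have hqS : q ∈ {p : E3 | ∃ m i j : ℤ, p = A (((i : ℝ) • triangularVec₁ a') +
        ((j : ℝ) • triangularVec₂ a') + ((haggLabel s m : ℝ) • barlowOffset a') +
        (z m • layerNormal 1))} := ⟨m, i, j, rfl⟩
    have hcq : c * ‖q‖ ≤ R := by rwa [norm_smul, Real.norm_eq_abs, abs_of_pos hc0] at hpR
    have hc1 : 47 / 50 ≤ c := by
      rw [hc, le_div_iff₀ ha'0]; nlinarith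
    have hqn : ‖q‖ ≤ 2 * R + 1 := by nlinarith [norm_nonneg q]
    obtain ⟨q₀, hq₀X, hq₀⟩ := h1 q hqS hqn
    refine ⟨q₀, hq₀X, ?_⟩
    have hqR' : ‖q‖ ≤ 2 * R + η / 2 := by nlinarith [norm_nonneg q]
    calc dist (q₀ + t) (c • q) ≤ dist (q₀ + t) q + dist q (c • q) := dist_triangle _ _ _
      _ ≤ η / 2 + |c - 1| * ‖q‖ := by rw [hdist]; linarith
      _ ≤ η / 2 + η / 2 := by
          linarith [hb_rescale_aux hR hη ha ha' ha'1 ha1 hXa haa (abs_nonneg _) hqR']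
      _ = η := by ring
  · intro q₀ hq₀X hq₀R
    have hq₀R' : ‖q₀ + t‖ ≤ 2 * R + 1 := by linarith
    obtain ⟨q, ⟨m, i', j', rfl⟩, hq⟩ := h2 q₀ hq₀X hq₀R'
    refine ⟨_, ⟨m, i', j', rfl⟩, ?_⟩
    rw [key]
    set q : E3 := A (((i' : ℝ) • triangularVec₁ a') + ((j' : ℝ) • triangularVec₂ a') +
      ((haggLabel s m : ℝ) • barlowOffset a') + (z m • layerNormal 1)) with hqdef
    have hqn : ‖q‖ ≤ 2 * R + η / 2 := by
      have : ‖q‖ ≤ ‖q₀ + t‖ + dist (q₀ + t) q := by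
        have := norm_le_norm_add_norm_sub' q (q₀ + t)
        rw [dist_eq_norm]
        linarith [norm_sub_rev (q₀ + t) q]
      linarith
    calc dist (q₀ + t) (c • q) ≤ dist (q₀ + t) q + dist q (c • q) := dist_triangle _ _ _
      _ ≤ η / 2 + |c - 1| * ‖q‖ := by rw [hdist]; linarith
      _ ≤ η / 2 + η / 2 := by
          linarith [hb_rescale_aux hR hη ha ha' ha'1 ha1 hXa haa (abs_nonneg _) hqn]
      _ = η := by ring

/-! ## One in-layer spacing for all scales (accumulation point + rescaling) -/

/-- **Choosing one in-layer spacing** (sequence version of `hb_exists_global_spacing`). Abstract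
form: `W R η ⊆ [47/50, 1]` is the set of admissible spacings of `(R, η)`-patches; if patches are
monotone in `(R, η)`, stable under the rescaling of `us_patch_rescale`, and exist for every
`(R, η)`, `η > 0`, then ONE spacing `a` serves every `(R, η)` (a cluster point of the spacings of
the `(k, 1/(k+1))`-patches; a negative radius is reduced to radius `max R 0` by monotonicity).
[folklore] -/
theorem us_exists_global_spacing (W : ℝ → ℝ → Set ℝ)
    (hbox : ∀ R η, W R η ⊆ Set.Icc (47 / 50 : ℝ) 1)
    (hmono : ∀ R R₂ η η₂, R₂ ≤ R → η ≤ η₂ → W R η ⊆ W R₂ η₂)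
    (hresc : ∀ R η a a', 0 ≤ R → 0 < η → a' ∈ W (2 * R + 1) (η / 2) →
      a ∈ Set.Icc (47 / 50 : ℝ) 1 → |a - a'| ≤ η / (8 * (R + 1)) → a ∈ W R η)
    (hne : ∀ R η, 0 < η → (W R η).Nonempty) :
    ∃ a ∈ Set.Icc (47 / 50 : ℝ) 1, ∀ R η, 0 < η → a ∈ W R η := by
  -- adapted from `hb_exists_global_spacing` (plain sequences instead of `∀ᶠ N`/`∃ᶠ N`)
  have h1 : ∀ k : ℕ, (W k (1 / ((k : ℝ) + 1))).Nonempty := fun k => hne k _ (by positivity)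
  choose aseq haseq using h1
  have hmem : ∀ k, aseq k ∈ Set.Icc (47 / 50 : ℝ) 1 := fun k => hbox _ _ (haseq k)
  obtain ⟨a, ha, ψ, hψ, hlim⟩ := isCompact_Icc.tendsto_subseq hmem
  refine ⟨a, ha, fun R' η hη => ?_⟩
  -- reduce to the nonnegative radius `R = max R' 0`
  suffices h : a ∈ W (max R' 0) η from hmono _ _ _ _ (le_max_left _ _) le_rfl h
  set R : ℝ := max R' 0 with hRdef
  have hR : 0 ≤ R := le_max_right _ _
  have hκ : 0 < η / (8 * (R + 1)) := by positivity
  have e1 : ∀ᶠ j in atTop, dist (aseq (ψ j)) a < η / (8 * (R + 1)) :=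
    (Metric.tendsto_nhds.1 hlim) _ hκ
  have hψ' : Tendsto (fun j => ((ψ j : ℕ) : ℝ)) atTop atTop :=
    tendsto_natCast_atTop_atTop.comp hψ.tendsto_atTop
  have e2 : ∀ᶠ j in atTop, 2 * R + 1 ≤ (ψ j : ℝ) := hψ'.eventually_ge_atTop _
  have e3 : ∀ᶠ j in atTop, 2 / η ≤ (ψ j : ℝ) := hψ'.eventually_ge_atTop _
  obtain ⟨j, hj1, hj2, hj3⟩ := (e1.and (e2.and e3)).exists
  have hmem' : aseq (ψ j) ∈ W (2 * R + 1) (η / 2) := by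
    refine hmono _ _ _ _ hj2 ?_ (haseq (ψ j))
    rw [div_le_iff₀ (by positivity)]
    have h2 : 2 ≤ η * (ψ j : ℝ) := by
      have := (div_le_iff₀ hη).1 hj3
      linarith
    nlinarith
  refine hresc _ _ _ _ hR hη hmem' ha ?_
  rw [abs_sub_comm, ← Real.dist_eq]
  exact hj1.le

/-! ## The registered stub -/

/-- STUB 2 (M) of line `Sketch` of the crux `BarlowLiouville` — one in-layer spacing serves all
scales: if for every `(R, η)` some translate of `X` is two-way `η`-matched on `‖·‖ ≤ R` with a
rigid image of a relaxed layered set of SOME spacing `a ∈ [47/50, 1]`, then ONE spacing `a` works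
for every `(R, η)` (compactness of `[47/50, 1]` and dilation covariance of the layered family:
`u(ca) = c•u(a)`, `v(ca) = c•v(a)`, `w(ca) = c•w(a)`, heights `c•z` keep the box). Pure geometry, no
hypothesis on `X`. [folklore] -/
theorem stub_uniformSpacing : ∀ X : Set E3,
    (∀ R η : ℝ, 0 < η → ∃ a : ℝ, 47 / 50 ≤ a ∧ a ≤ 1 ∧
      ∃ (A : E3 →ₗᵢ[ℝ] E3) (t : E3) (s : ℤ → ℤ) (z : ℤ → ℝ), IsHaggSeq s ∧
        (∀ m : ℤ, 39 / 50 * a ≤ z (m + 1) - z m ∧ z (m + 1) - z m ≤ 17 / 20 * a) ∧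
        let S : Set E3 := {p | ∃ m i j : ℤ, p = A (((i : ℝ) • triangularVec₁ a) +
          ((j : ℝ) • triangularVec₂ a) + ((haggLabel s m : ℝ) • barlowOffset a) + (z m • layerNormal 1))}
        (∀ p ∈ S, ‖p‖ ≤ R → ∃ q ∈ X, dist (q + t) p ≤ η) ∧
        (∀ q ∈ X, ‖q + t‖ ≤ R → ∃ p ∈ S, dist (q + t) p ≤ η)) →
    ∃ a : ℝ, 47 / 50 ≤ a ∧ a ≤ 1 ∧ ∀ R η : ℝ, 0 < η →
      ∃ (A : E3 →ₗᵢ[ℝ] E3) (t : E3) (s : ℤ → ℤ) (z : ℤ → ℝ), IsHaggSeq s ∧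
        (∀ m : ℤ, 39 / 50 * a ≤ z (m + 1) - z m ∧ z (m + 1) - z m ≤ 17 / 20 * a) ∧
        let S : Set E3 := {p | ∃ m i j : ℤ, p = A (((i : ℝ) • triangularVec₁ a) +
          ((j : ℝ) • triangularVec₂ a) + ((haggLabel s m : ℝ) • barlowOffset a) + (z m • layerNormal 1))}
        (∀ p ∈ S, ‖p‖ ≤ R → ∃ q ∈ X, dist (q + t) p ≤ η) ∧
        (∀ q ∈ X, ‖q + t‖ ≤ R → ∃ p ∈ S, dist (q + t) p ≤ η) := by
  intro X hX
  obtain ⟨a, ha, hW⟩ := us_exists_global_spacing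
    (fun R η => {a : ℝ | 47 / 50 ≤ a ∧ a ≤ 1 ∧
      ∃ (A : E3 →ₗᵢ[ℝ] E3) (t : E3) (s : ℤ → ℤ) (z : ℤ → ℝ), IsHaggSeq s ∧
        (∀ m : ℤ, 39 / 50 * a ≤ z (m + 1) - z m ∧ z (m + 1) - z m ≤ 17 / 20 * a) ∧
        let S : Set E3 := {p | ∃ m i j : ℤ, p = A (((i : ℝ) • triangularVec₁ a) +
          ((j : ℝ) • triangularVec₂ a) + ((haggLabel s m : ℝ) • barlowOffset a) + (z m • layerNormal 1))}
        (∀ p ∈ S, ‖p‖ ≤ R → ∃ q ∈ X, dist (q + t) p ≤ η) ∧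
        (∀ q ∈ X, ‖q + t‖ ≤ R → ∃ p ∈ S, dist (q + t) p ≤ η)})
    (fun _ _ _ hb => ⟨hb.1, hb.2.1⟩)
    (fun _ _ _ _ hR hη _ hb => ⟨hb.1, hb.2.1, us_patch_mono X hR hη hb.2.2⟩)
    (fun _ _ _ _ hR hη hb' hb haa =>
      ⟨hb.1, hb.2, us_patch_rescale X hR hη hb.1 hb.2 hb'.1 hb'.2.1 haa hb'.2.2⟩)
    (fun R η hη => by
      obtain ⟨b, hb, hb1, h⟩ := hX R η hη
      exact ⟨b, hb, hb1, h⟩)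
  exact ⟨a, ha.1, ha.2, fun R η hη => (hW R η hη).2.2⟩

end Summit.AtomisticToContinuum.Crystallization.Theorems.DisclinationRationBarlowLiouville
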